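import Summits.BirchSwinnertonDyer.Rank1Residual.GaloisImage.MultiplicativeCartanNormalizer
import Summits.BirchSwinnertonDyer.BirchSwinnertonDyer.Theorems.ErratumRoadFiveShimuraKolyvaginOrderBoundInertLocalSplit
import Literature.NumberTheory.EllipticCurves.HeegnerPointsKolyvaginCebotarevProofs
import Literature.NumberTheory.GaloisRepresentations.FrobeniusPlaces
import HarnessLib

/-!
# `ρ̄_{E,3}(Γ_K)` is non-abelian for a multiplicative `3`, irreducible `E[3]`, and `K` with `3` inert — step (A1) of the
# split prime-conductor Chebotarev–Kummer supply (c′)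
# (cell `bsd-stepL`, seat `bsd-stepL-corner3-p2` g15 = lane B, LINE OWNER of crux 21420 `CornerAtThreeW`; `--supports stmt-BirchSwinnertonDyer-21420 --as helper`)

WHY. Conjunct (c′) of the r18/r19 residual stub of `Cruxes/CornerAtThreeW/Lines/inert.lean` (lane B g14 memo CORNER3-G14
§6–§7) is proved by Chebotarev's theorem applied to a witness `γ ∈ Γ_K` acting as `−I` on `E[3]` and trivially on the
abelian extension `K[m₀](μ_{3^E})` of `K`. Such a witness is a (power of a) COMMUTATOR of two elements of `Γ_K` whose images
in `Aut(E[3])` do not commute (lane B g15 `…ModThreeCommutatorNegOne`: a non-trivial commutator of the image is `−1` or has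
square `−1`). THIS FILE supplies the non-commuting pair (`exists_noncommuting_pair_of_mult_of_irr`): for `E = W/ℚ` with
MULTIPLICATIVE reduction at `3` and `E[3]` IRREDUCIBLE, and `K` imaginary quadratic with `3` INERT and `3 ∤ d_K`, there are
`a, b ∈ Γ_K = res(Gal(K̄/K)) ≤ Γ_ℚ` with `ρ̄(ab) ≠ ρ̄(ba)`.
PROOF. Serre §1.12 at the multiplicative prime `3` (tree `exists_inertia_line_of_mult`, frame-free): at a prime `𝔏 ∣ 3` of `ℤ̄`
there is `v₀ ∈ E[3] ∖ 0` with the inertia group `I_𝔏` acting trivially on `E[3]/𝔽₃v₀` and through all of `𝔽₃ˣ` on `𝔽₃v₀`;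
pick `σ₃ ∈ I_𝔏` with `σ₃ v₀ = −v₀`. As `3 ∤ d_K`, `I_𝔏 ≤ Γ_K` (tree `inertia_le_range_absGaloisRestrict_of_isUnramifiedIn`). If
`ρ̄(Γ_K)` were abelian, every `a ∈ Γ_K` would commute with `σ₃`, so preserve the `(−1)`-eigenline `𝔽₃v₀` of `σ₃`; by
irreducibility some `g ∈ Γ_ℚ` moves `v₀` off that line, `v₁ := g v₀`; `Γ_K ⊴ Γ_ℚ` then also preserves `𝔽₃v₁ = g(𝔽₃v₀)`, and
`I_𝔏 ≤ Γ_K` acts trivially on `E[3]/𝔽₃v₀`, hence FIXES `v₁`. Since `3` is INERT in `K`, the primes `𝔏` and `g⁻¹𝔏` of `ℤ̄` lie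
over the same place of `K`, so `a₀ 𝔏 = g⁻¹ 𝔏` for some `a₀ ∈ Γ_K` (transitivity of `Gal(K̄/K)`, tree
`exists_smul_eq_of_mem_primesAbove_holds` + `FrobeniusPlaces`); `h := g a₀` stabilises `𝔏`, so `h I_𝔏 h⁻¹ = I_𝔏` fixes `v₁`,
i.e. `I_𝔏` fixes `h⁻¹ v₁ = a₀⁻¹ v₀ ∈ 𝔽₃ˣ v₀` — contradicting `σ₃ v₀ = −v₀ ≠ v₀`.
HONEST FRAMING: THEOREMS ONLY (no definition, no named fact, no `sorry`); Galois-module bookkeeping on `E[3]`; nothing about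
any CM point or any crux object; no stub ∕ item closes; 21420 OPEN; no census label moves (T7); BSD is proved for no curve.
References (locators only): [cite: Serre1972, §1.12 Cor. of Prop. 13, §2.1 a)] [cite: NeukirchANT1999, Ch. I §9 Prop. (9.1)].
presearch: in-tree (`MultiplicativeCartanNormalizer`, `HeegnerPointsKolyvaginCebotarevProofs`, `FrobeniusPlaces`,
`IntegralGaloisActionProofs`). Axioms: `propext`, `Classical.choice`, `Quot.sound`.
-/

set_option autoImplicit false
set_option linter.dupNamespace false

noncomputable section

open scoped Classical NumberField Pointwise

namespace Summit.BirchSwinnertonDyer.BirchSwinnertonDyer.Theorems.ChebKummerThree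

open WeierstrassCurve NumberField Field IsDedekindDomain Rat.HeightOneSpectrum
  Literature.NumberTheory.GaloisRepresentations Literature.NumberTheory.EllipticCurves
  Summit.BirchSwinnertonDyer.Rank1Residual.GaloisImage

/-! ### §1 Plumbing -/

/-- `ℓ ∤ d_K` ⟹ every place `v ∋ ℓ` of `𝓞 ℚ` is unramified in `K` (Dedekind; Mathlib `NumberField.not_dvd_discr_iff_isUnramifiedIn`
over `ℤ`, re-based from `(ℓ) ⊂ ℤ` to `v ⊂ 𝓞 ℚ`).
-- adapted from Summits/BirchSwinnertonDyer/BirchSwinnertonDyer/Theorems/ClassRecordThreeCornerAtThreeShimuraInertDisplayOfPrimitives.lean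
[cite: NeukirchANT1999, Ch. III Thm. (2.12) and Cor.] -/
theorem isUnramifiedIn_rat_of_not_dvd_discr' (K : Type) [Field K] [NumberField K] {ℓ : ℕ} (hℓ : ℓ.Prime)
    (hd : ¬ (ℓ : ℤ) ∣ NumberField.discr K) {v : HeightOneSpectrum (𝓞 ℚ)} (hℓv : (ℓ : 𝓞 ℚ) ∈ v.asIdeal) :
    Algebra.IsUnramifiedIn (𝓞 K) v.asIdeal := by
  rw [Algebra.isUnramifiedIn_iff_forall_ramificationIdx_eq_one]
  intro P _ hP
  haveI := hP
  have hℓZ : Prime (ℓ : ℤ) := Nat.prime_iff_prime_int.mp hℓ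
  have hunr : Algebra.IsUnramifiedIn (𝓞 K) (Ideal.span {(ℓ : ℤ)}) :=
    (NumberField.not_dvd_discr_iff_isUnramifiedIn K (𝓞 K) hℓZ).mp hd
  haveI : v.asIdeal.LiesOver (Ideal.span {(ℓ : ℤ)}) := by
    rw [Ideal.liesOver_iff]
    have hmax : (Ideal.span {(ℓ : ℤ)}).IsMaximal :=
      PrincipalIdealRing.isMaximal_of_irreducible hℓZ.irreducible
    haveI : (v.asIdeal.under ℤ).IsPrime := Ideal.IsPrime.under ℤ v.asIdeal
    refine hmax.eq_of_le (Ideal.IsPrime.ne_top ‹_›) ?_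
    rw [Ideal.span_le, Set.singleton_subset_iff, SetLike.mem_coe, Ideal.under_def, Ideal.mem_comap,
      map_natCast]
    exact hℓv
  haveI : P.LiesOver (Ideal.span {(ℓ : ℤ)}) := Ideal.LiesOver.trans P v.asIdeal _
  have h1 : P.ramificationIdx ℤ = 1 :=
    (Algebra.isUnramifiedIn_iff_forall_ramificationIdx_eq_one.mp hunr) P ‹_›
  rw [Ideal.ramificationIdx_tower (R := ℤ) v.asIdeal P] at h1
  exact Nat.eq_one_of_mul_eq_one_left h1

/-- Conjugation moves inertia groups along: `τ ∈ I_𝔏 ⟹ g τ g⁻¹ ∈ I_{g𝔏}`. [folklore] -/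
theorem conj_mem_inertia_smul {G R : Type*} [Group G] [Ring R] [MulSemiringAction G R]
    {𝔏 : Ideal R} {τ : G} (hτ : τ ∈ 𝔏.inertia G) (g : G) :
    g * τ * g⁻¹ ∈ (g • 𝔏).inertia G := by
  intro x
  have h : (g * τ * g⁻¹) • x - x = g • (τ • (g⁻¹ • x) - g⁻¹ • x) := by
    rw [smul_sub, mul_smul, mul_smul, smul_inv_smul]
  rw [Submodule.mem_toAddSubgroup, h, Ideal.smul_mem_pointwise_smul_iff]
  exact hτ (g⁻¹ • x)

/-- **`3` inert in `K` ⟹ `Γ_K` is transitive on the primes of `ℤ̄` above `3`**: for `K` imaginary quadratic with exactly one prime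
above the rational prime `ℓ` and `ℓ ∤ d_K`, a prime `𝔏 ∣ ℓ` of `ℤ̄ = \bar ℤ_ℚ` and any `g ∈ Γ_ℚ`, there is `a₀ ∈ res(Gal(K̄/K))` with
`a₀ 𝔏 = g 𝔏` (both `ι 𝔏` and `ι(g𝔏)` lie over the unique place `(ℓ)` of `K`; `Gal(K̄/K)` is transitive on the primes of `\bar ℤ_K`
above it). [cite: NeukirchANT1999, Ch. I §9 Prop. (9.1)] -/
theorem exists_mem_range_smul_eq_smul_of_inert (K : Type) [Field K] [NumberField K] (hK : IsImaginaryQuadratic K)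
    {ℓ : ℕ} (hℓ : ℓ.Prime) (hg1 : ((Ideal.span {(ℓ : ℤ)}).primesOver (𝓞 K)).ncard = 1)
    (hd : ¬ (ℓ : ℤ) ∣ NumberField.discr K)
    {v : HeightOneSpectrum (𝓞 ℚ)} (hℓv : (ℓ : 𝓞 ℚ) ∈ v.asIdeal)
    {𝔏 : Ideal (absIntegers (𝓞 ℚ) ℚ)} (h𝔏 : 𝔏 ∈ v.primesAbove) (g : absoluteGaloisGroup ℚ) :
    ∃ a₀ ∈ (absGaloisRestrict ℚ K).range, a₀ • 𝔏 = g • 𝔏 := by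
  haveI : Algebra.IsAlgebraic ℚ K := Algebra.IsAlgebraic.of_finite ℚ K
  obtain ⟨𝔔, w, h𝔔, hw, h𝔔w⟩ := exists_place_comap_eq_smul (F := ℚ) (M := K) h𝔏 1
  obtain ⟨𝔔', w', h𝔔', hw', h𝔔'w'⟩ := exists_place_comap_eq_smul (F := ℚ) (M := K) h𝔏 g
  rw [one_smul] at h𝔔
  -- both places contain `ℓ`, hence coincide (`ℓ` inert)
  have hmem : ∀ u : HeightOneSpectrum (𝓞 K), u.asIdeal.under (𝓞 ℚ) = v.asIdeal → ((ℓ : ℕ) : 𝓞 K) ∈ u.asIdeal := by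
    intro u hu
    have h1 : (ℓ : 𝓞 ℚ) ∈ u.asIdeal.under (𝓞 ℚ) := by rw [hu]; exact hℓv
    rw [Ideal.under_def, Ideal.mem_comap, map_natCast] at h1
    exact h1
  have hww' : w = w' := by
    apply HeightOneSpectrum.ext
    rw [asIdeal_eq_span_natCast_of_ncard_primesOver_eq_one hK hℓ hg1 hd (hmem w hw),
      asIdeal_eq_span_natCast_of_ncard_primesOver_eq_one hK hℓ hg1 hd (hmem w' hw')]
  subst hww'
  obtain ⟨δ, hδ⟩ := HeightOneSpectrum.exists_smul_eq_of_mem_primesAbove_holds h𝔔w h𝔔'w'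
  refine ⟨absGaloisRestrict ℚ K δ, ⟨δ, rfl⟩, ?_⟩
  rw [← h𝔔', ← hδ, comap_absIntegersMap_smul, h𝔔]

/-- `2 = 1 + 1` in `𝔽₃`. [folklore] -/
private theorem zmod3_two_eq : (2 : ZMod 3) = 1 + 1 := by decide

/-- `2 · 2 = 1` in `𝔽₃`. [folklore] -/
private theorem zmod3_two_mul_two : (2 : ZMod 3) * 2 = 1 := by decide

/-- `1 = (−1) + (−1)` in `𝔽₃`. [folklore] -/
private theorem zmod3_one_eq : (1 : ZMod 3) = -1 + -1 := by decide

/-! ### §2 The non-commuting pair -/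

variable (W : WeierstrassCurve ℚ) [W.IsElliptic]

set_option synthInstance.maxHeartbeats 400000 in
-- the pointwise `Γ_ℚ`-action on the ideals of `ℤ̄` is slow to synthesise in this import context
/-- **`ρ̄_{E,3}(Γ_K)` is non-abelian** — for `E = W/ℚ` with multiplicative reduction at `3` and `E[3]` irreducible, and `K` imaginary
quadratic in which `3` is inert (`#{𝔭 ∣ 3} = 1`, `3 ∤ d_K`): there are `a, b` in `Γ_K = res(Gal(K̄/K)) ≤ Γ_ℚ` with `ρ̄(ab) ≠ ρ̄(ba)` on
`E[3]`. Proof in the module docstring (inertia line at `3`, Serre §1.12; `I_𝔏 ≤ Γ_K`; irreducibility; transitivity of `Γ_K` on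
the primes above the inert `3`). [cite: Serre1972, §1.12 Cor. of Prop. 13, §2.1 a)] [cite: NeukirchANT1999, Ch. I §9 Prop. (9.1)] -/
theorem exists_noncommuting_pair_of_mult_of_irr [Fact (Nat.Prime 3)]
    (hmult : W.HasMultiplicativeReductionAtPrime 3) (hirr : W.HasIrreducibleModPGaloisRep 3)
    (K : Type) [Field K] [NumberField K] (hK : IsImaginaryQuadratic K)
    (h3 : ((Ideal.span {(3 : ℤ)}).primesOver (𝓞 K)).ncard = 1) (h3d : ¬ (3 : ℤ) ∣ NumberField.discr K) :
    ∃ a ∈ (absGaloisRestrict ℚ K).range, ∃ b ∈ (absGaloisRestrict ℚ K).range,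
      galoisRepTorsion W (3 : ℕ) (a * b) ≠ galoisRepTorsion W (3 : ℕ) (b * a) := by
  letI : Module (ZMod 3) (geomTorsion W (3 : ℕ)) := AddSubgroup.torsionBy.zmodModule
  haveI : Algebra.IsQuadraticExtension ℚ K := ⟨hK.1⟩
  haveI : IsGalois ℚ K := inferInstance
  set H := (absGaloisRestrict ℚ K).range with hHdef
  haveI hHn : H.Normal :=
    Subgroup.normal_of_index_eq_two ((index_range_absGaloisRestrict_eq_finrank ℚ K).trans hK.1)
  set ρ := galoisRepTorsion W (3 : ℕ) with hρ
  -- linearity of the Galois action on `E[3]`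
  have hlin : ∀ (σ : absoluteGaloisGroup ℚ) (c : ZMod 3) (P : geomTorsion W (3 : ℕ)), σ • (c • P) = c • (σ • P) := by
    intro σ c P
    exact ((ρ σ).toAdd.toAddMonoidHom.toZModLinearMap 3).map_smul c P
  -- the place of `ℚ` at `3` and a prime `𝔏 ∣ 3` of `ℤ̄`
  set v : HeightOneSpectrum (𝓞 ℚ) := (primesEquiv (R := 𝓞 ℚ)).symm ⟨3, Nat.prime_three⟩ with hvdef
  have hv' : primesEquiv v = ⟨3, Nat.prime_three⟩ := Equiv.apply_symm_apply _ _
  have hv : (primesEquiv v : ℕ) = 3 := congrArg Subtype.val hv'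
  have hv3 : ((3 : ℕ) : 𝓞 ℚ) ∈ v.asIdeal := by
    have hgen : natGenerator v = 3 := hv
    have h := (natGenerator_dvd_iff v).mp dvd_rfl
    rw [← map_natCast (Rat.IsIntegralClosure.intEquiv (𝓞 ℚ)), Ideal.apply_mem_of_equiv_iff] at h
    rwa [hgen] at h
  obtain ⟨𝔏, h𝔏⟩ := HeightOneSpectrum.primesAbove_nonempty v
  -- Serre §1.12: the inertia line `𝔽₃ v₀` and `σ₃ ∈ I_𝔏` with `σ₃ v₀ = -v₀`
  obtain ⟨v₀, hv₀, hquot, hsurj⟩ := exists_inertia_line_of_mult W 3 (by norm_num) hmult hv h𝔏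
  obtain ⟨σ₃, hσ₃I, hσ₃⟩ := hsurj (-1)
  rw [Units.val_neg, Units.val_one, neg_one_smul] at hσ₃
  -- `I_𝔏 ≤ Γ_K` (`3 ∤ d_K`)
  have hunr : Algebra.IsUnramifiedIn (𝓞 K) v.asIdeal := isUnramifiedIn_rat_of_not_dvd_discr' K Nat.prime_three h3d hv3
  have hIH : 𝔏.inertia (absoluteGaloisGroup ℚ) ≤ H := inertia_le_range_absGaloisRestrict_of_isUnramifiedIn hunr h𝔏
  -- elementary facts in the `𝔽₃`-space `E[3]`
  have hneg_ne : ∀ P : geomTorsion W (3 : ℕ), P ≠ 0 → -P ≠ P := by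
    intro P hP h
    apply hP
    have h2 : (2 : ZMod 3) • P = 0 := by
      rw [zmod3_two_eq, add_smul, one_smul]
      nth_rewrite 1 [← h]
      rw [neg_add_cancel]
    calc P = ((2 : ZMod 3) * 2) • P := by rw [zmod3_two_mul_two, one_smul]
      _ = 0 := by rw [mul_smul, h2, smul_zero]
  -- suppose, for contradiction, that `ρ̄(Γ_K)` is abelian
  by_contra hcon
  push Not at hcon
  have hcomm : ∀ a ∈ H, ∀ b ∈ H, ∀ P : geomTorsion W (3 : ℕ), a • (b • P) = b • (a • P) := by
    intro a ha b hb P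
    rw [← mul_smul, ← mul_smul]
    change (ρ (a * b)).toAdd P = (ρ (b * a)).toAdd P
    rw [hcon a ha b hb]
  -- (C1) every `a ∈ Γ_K` maps `v₀` into `𝔽₃ v₀`
  have hC1 : ∀ a ∈ H, ∃ c : ZMod 3, a • v₀ = c • v₀ := by
    intro a ha
    set Q := a • v₀ with hQ
    have hσQ : σ₃ • Q = -Q := by rw [hQ, hcomm σ₃ (hIH hσ₃I) a ha, hσ₃, smul_neg]
    obtain ⟨b, hb⟩ := hquot σ₃ hσ₃I Q
    refine ⟨b, ?_⟩
    rw [hσQ] at hb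
    have h1 : -Q - Q = (1 : ZMod 3) • Q := by
      rw [zmod3_one_eq, add_smul, neg_one_smul, sub_eq_add_neg]
    rw [h1, one_smul] at hb
    exact hb
  -- the line `𝔽₃ v₀` is not `Γ_ℚ`-stable (irreducibility): some `g` moves `v₀` off it
  have hex : ∃ g : absoluteGaloisGroup ℚ, ∀ c : ZMod 3, g • v₀ ≠ c • v₀ := by
    by_contra hall
    push Not at hall
    let L : AddSubgroup (geomTorsion W (3 : ℕ)) :=
      { carrier := {P | ∃ c : ZMod 3, P = c • v₀}
        zero_mem' := ⟨0, by rw [zero_smul]⟩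
        add_mem' := by
          rintro P Q ⟨a, rfl⟩ ⟨b, rfl⟩
          exact ⟨a + b, by rw [add_smul]⟩
        neg_mem' := by
          rintro P ⟨a, rfl⟩
          exact ⟨-a, by rw [neg_smul]⟩ }
    have hmemL : ∀ P : geomTorsion W (3 : ℕ), P ∈ L ↔ ∃ c : ZMod 3, P = c • v₀ := fun P ↦ Iff.rfl
    have hstab : ∀ σ : absoluteGaloisGroup ℚ, ∀ P ∈ L, σ • P ∈ L := by
      intro σ P hP
      obtain ⟨c, rfl⟩ := (hmemL P).mp hP
      obtain ⟨d, hd⟩ := hall σ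
      exact (hmemL _).mpr ⟨c * d, by rw [hlin, hd, smul_smul]⟩
    rcases hirr L hstab with hbot | htop
    · have : v₀ ∈ L := (hmemL v₀).mpr ⟨1, by rw [one_smul]⟩
      rw [hbot, AddSubgroup.mem_bot] at this
      exact hv₀ this
    · -- `#E[3] = 9` but the line has at most `3` elements
      have hcard : Nat.card (geomTorsion W (3 : ℕ)) = 3 ^ 2 :=
        card_torsionPoints_eq_sq_holds W (AlgebraicClosure ℚ) (n := 3) (by norm_num)
      have hsurjL : Function.Surjective (fun c : ZMod 3 ↦ c • v₀) := by
        intro P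
        have hP : P ∈ L := htop ▸ AddSubgroup.mem_top P
        obtain ⟨c, rfl⟩ := (hmemL P).mp hP
        exact ⟨c, rfl⟩
      have hle := Nat.card_le_card_of_surjective _ hsurjL
      rw [hcard, Nat.card_zmod] at hle
      norm_num at hle
  obtain ⟨g, hg⟩ := hex
  set v₁ := g • v₀ with hv₁
  -- (C2) every `a ∈ Γ_K` maps `v₁` into `𝔽₃ v₁` (`Γ_K ⊴ Γ_ℚ`)
  have hC2 : ∀ a ∈ H, ∃ c : ZMod 3, a • v₁ = c • v₁ := by
    intro a ha
    obtain ⟨c, hc⟩ := hC1 (g⁻¹ * a * g) (hHn.conj_mem' a ha g)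
    refine ⟨c, ?_⟩
    calc a • v₁ = g • ((g⁻¹ * a * g) • v₀) := by rw [hv₁, mul_smul, mul_smul, smul_inv_smul]
      _ = c • v₁ := by rw [hc, hlin, hv₁]
  -- (*) inertia fixes `v₁`
  have hfix : ∀ τ ∈ 𝔏.inertia (absoluteGaloisGroup ℚ), τ • v₁ = v₁ := by
    intro τ hτ
    obtain ⟨c, hc⟩ := hC2 τ (hIH hτ)
    obtain ⟨b, hb⟩ := hquot τ hτ v₁
    rw [hc] at hb
    -- `(c - 1) v₁ = b v₀`
    have hcb : (c - 1) • v₁ = b • v₀ := by rw [sub_smul, one_smul, hb]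
    by_cases hc1 : c = 1
    · rw [hc, hc1, one_smul]
    · exfalso
      apply hg ((c - 1)⁻¹ * b)
      have hne : c - 1 ≠ 0 := sub_ne_zero.mpr hc1
      calc g • v₀ = v₁ := rfl
        _ = ((c - 1)⁻¹ * (c - 1)) • v₁ := by rw [inv_mul_cancel₀ hne, one_smul]
        _ = ((c - 1)⁻¹ * b) • v₀ := by rw [mul_smul, hcb, smul_smul]
  -- transitivity: `a₀ 𝔏 = g⁻¹ 𝔏` with `a₀ ∈ Γ_K`; `h = g a₀` stabilises `𝔏`
  obtain ⟨a₀, ha₀H, ha₀⟩ := exists_mem_range_smul_eq_smul_of_inert K hK Nat.prime_three h3 h3d hv3 h𝔏 g⁻¹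
  set h := g * a₀ with hhdef
  have hh𝔏 : h • 𝔏 = 𝔏 := by
    rw [hhdef, mul_smul g a₀ 𝔏, ha₀, smul_inv_smul]
  -- `I_𝔏` fixes `h⁻¹ v₁ = a₀⁻¹ v₀ = c₀ v₀`
  obtain ⟨c₀, hc₀⟩ := hC1 a₀⁻¹ (H.inv_mem ha₀H)
  have hc₀ne : c₀ ≠ 0 := by
    intro h0
    rw [h0, zero_smul, smul_eq_zero_iff_eq] at hc₀
    exact hv₀ hc₀
  have hfix₀ : ∀ τ ∈ 𝔏.inertia (absoluteGaloisGroup ℚ), τ • v₀ = v₀ := by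
    intro τ hτ
    have hconj : h * τ * h⁻¹ ∈ 𝔏.inertia (absoluteGaloisGroup ℚ) := by
      have := conj_mem_inertia_smul hτ h
      rwa [hh𝔏] at this
    have h1 := hfix _ hconj
    -- `τ • (h⁻¹ v₁) = h⁻¹ v₁`
    have h2 : τ • (h⁻¹ • v₁) = h⁻¹ • v₁ := by
      have h1' : h⁻¹ • ((h * τ * h⁻¹) • v₁) = h⁻¹ • v₁ := by rw [h1]
      rwa [mul_smul, mul_smul, inv_smul_smul] at h1'
    have h3 : h⁻¹ • v₁ = c₀ • v₀ := by
      rw [hhdef, hv₁, mul_inv_rev, mul_smul, inv_smul_smul, hc₀]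
    rw [h3, hlin] at h2
    calc τ • v₀ = (c₀⁻¹ * c₀) • (τ • v₀) := by rw [inv_mul_cancel₀ hc₀ne, one_smul]
      _ = c₀⁻¹ • (c₀ • v₀) := by rw [mul_smul, h2]
      _ = v₀ := by rw [smul_smul, inv_mul_cancel₀ hc₀ne, one_smul]
  -- contradiction with `σ₃ v₀ = -v₀ ≠ v₀`
  exact hneg_ne v₀ hv₀ (hσ₃ ▸ hfix₀ σ₃ hσ₃I)

end Summit.BirchSwinnertonDyer.BirchSwinnertonDyer.Theorems.ChebKummerThree

end
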